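import Mathlib.Algebra.DirectSum.Module
import Mathlib.LinearAlgebra.TensorProduct.Basic
import Mathlib.Algebra.Algebra.Bilinear
import Mathlib.Algebra.Module.LinearMap.End
import HarnessLib

/-!
# Heisenberg (super)algebra representations on a bigraded Fock space — the algebraic interface of the
Nakajima–Grojnowski–Lehn operator calculus

Layer `Literature/AlgebraicGeometry/HilbertScheme`.  Pure algebra (definitions and formal lemmas, NO named
facts): the vocabulary in which the cohomology `ℍ = ⨁ₙ H*(S^[n])` of all Hilbert schemes of points of a smooth
projective surface `S` is organised by Nakajima's operators `𝔮ₘ(α)`, `m ∈ ℤ`, `α ∈ H*(S)`.  The GEOMETRIC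
identification (Nakajima 1997, Grojnowski 1996; cup products: Lehn 1999, Li–Qin–Wang 2002) is recorded on the
tree's real carriers in the sequel `HilbertScheme/NakajimaOperators` as hypothesis structures + named facts; this
file only fixes the shape of the data and the axioms, so that the same words serve the real carriers
(`A i = Hⁱ(S(ℂ); ℂ)`, `Φ n i = Hⁱ(S^[n](ℂ); ℂ)`) and any explicit model.

## Sources (read; PDF pages of the materialised texts)

* W.-P. Li, Z. Qin, W. Wang, *Vertex algebras and the cohomology ring structure of Hilbert schemes of points
  on surfaces*, Math. Ann. 324 (2002) (arXiv:math/0009132), §2: Def. 2.5 p. 4 ("`ℍ = ⨁_{n,i ≥ 0} ℍ^{n,i}`,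
  `ℍ^{n,i} = Hⁱ(X^[n])` … the element `1 ∈ H⁰(X^[0]) = ℚ` is called the vacuum vector … `𝔣` is homogeneous of
  bi-degree `(ℓ, m)` if `𝔣(ℍ^{n,i}) ⊂ ℍ^{n+ℓ,i+m}`"), (2.7) p. 4 (the Lie superalgebra bracket
  `[𝔣, 𝔤] = 𝔣𝔤 − (−1)^{m m₁} 𝔤𝔣` for bi-degrees `(ℓ, m)`, `(ℓ₁, m₁)`), Def. 2.9 p. 4–5 (`𝔮ₙ`, `𝔮₀ = 0`; "`𝔮ₙ(α)` …
  homogeneous of bi-degree `(n, 2n − 2 + |α|)`"), Thm. 2.16 (i) p. 5 ("`[𝔮ₙ(α), 𝔮ₘ(β)] = n · δ_{n+m} · ∫_X(αβ) ·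
  Id_ℍ`"), and p. 5 last paragraph ("`ℍ` is an irreducible representation of the Heisenberg algebra generated
  by the `𝔮ᵢ(α)`'s with `|0⟩ ∈ H⁰(X^[0])` being the highest weight vector").
* M. Lehn, *Chern classes of tautological sheaves on Hilbert schemes of points on surfaces*, Invent. Math. 136
  (1999) (arXiv:math/9803091), Def. 2.3–2.4, Thm. 2.5, Cor. 2.6 p. 7–8 ("`S*W₊ → ℍ` is a module isomorphism. In
  particular, `ℍ` is irreducible and generated by the vacuum vector"); §3.1 p. 8 ("`δ : H*(X) → H*(X × X) =
  H*(X) ⊗ H*(X)` … the push-forward map associated to the diagonal embedding. Equivalently, this is the linear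
  map adjoint to the cup-product map").
* G. Oberdieck, *A Lie algebra action on the Chow ring of the Hilbert scheme of points of a K3 surface*, Comment.
  Math. Helv. 96 (2021) (arXiv:1908.08830), §3.2 p. 7 (the operator `T_Γ = −Σ_{n>0} n^{deg Γ − 3} 𝔮ₙ𝔮₋ₙ(Γ′)` of
  a correspondence `Γ` on `S`, "general remarks that hold for every smooth projective surface `S`").

## Rendering (design)

* CARRIERS are EXTERNALLY graded, as the tree's `Hyperkaehler.totalCohomology R Y = ⨁ₖ Hᵏ(Y; R)` is: the
  coefficient space is `⨁ᵢ A i` for a family `A : ℕ → Type` (homogeneous elements `lof i a`; the PARITY of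
  `lof i a` is `i mod 2`), the Fock carrier is `Fock Φ = ⨁ₙ ⨁ᵢ Φ n i` for `Φ : ℕ → ℕ → Type` (`Φ n i = ℍ^{n,i}`),
  and `bidegPart Φ p d ⊆ Fock Φ` (`p, d ∈ ℤ`) is the summand `ℍ^{p,d}`, `⊥` for `p < 0` or `d < 0` — so that
  "bi-degree `(ℓ, m)`" with `ℓ ∈ ℤ` is one membership statement.  On the real carriers `⨁ᵢ A i` IS
  `totalCohomology ℂ S(ℂ)` and `Fock Φ` IS `⨁ₙ totalCohomology ℂ S^[n](ℂ)` (same terms).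
* `IsHeisenbergRepresentation B q vac` — the AXIOMS, for a pairing `B` on `⨁ᵢ A i` (intended `⟨α, β⟩ = ∫_S αβ`),
  operators `q : ℤ → (⨁ᵢ A i) →ₗ End(Fock Φ)` and a vector `vac`: `𝔮₀ = 0`; the Heisenberg SUPER-relations in
  the form (2.7)/(2.16 (i)) `𝔮ₘ(a)𝔮ₗ(b) − (−1)^{ij} 𝔮ₗ(b)𝔮ₘ(a) = δ_{m+l,0} · m⟨a, b⟩ · Id` for `a ∈ A i`,
  `b ∈ A j`; the bi-degree `(m, 2m − 2 + i)` of `𝔮ₘ(a)`; `vac ∈ ℍ^{0,0}`, `vac ≠ 0`; and CYCLICITY ("generated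
  by the vacuum vector": the only submodule containing `vac` and stable under the creation operators `𝔮ₘ`, `m > 0`,
  is everything — the spanning half of the PBW basis).  Irreducibility and the
  PBW basis (Lehn Cor. 2.6) are consequences once `B` is non-degenerate and are not axioms; `𝔮ₘ vac = 0` for
  `m < 0` is a consequence of the bi-degree axiom (`q_apply_vac_eq_zero`).
* Two-point operators WITHOUT a Künneth decomposition: every printed quadratic expression `𝔮ₘ𝔮ₗ(δγ)`,
  `𝔮ₙ𝔮₋ₙ(Γ′)` is the image of a tensor in `(⨁A) ⊗ (⨁A)` under `pairOp q m l` (the linear extension of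
  `a ⊗ b ↦ 𝔮ₘ(a)𝔮ₗ(b)`).  The tensors themselves are supplied through a CASIMIR element `C = Σ eᵢ ⊗ εᵢ` of `B`
  (`IsCasimir B C`: `Σᵢ ⟨eᵢ, v⟩ εᵢ = v` for all `v`; it exists and is unique when `B` is non-degenerate on a
  finite-dimensional space — Poincaré duality on the real carriers — and encodes Lehn's `δ = `adjoint of cup
  product: `δ(γ) = Σᵢ eᵢ ⊗ γεᵢ` up to the graded swap): a correspondence/endomorphism `φ` of the coefficient
  space gives Oberdieck's TRANSFER operator `transferOp q C t φ = −Σ_{n ≥ 1} n^{t−1} Σᵢ 𝔮ₙ(φ εᵢ) 𝔮₋ₙ(eᵢ)`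
  (`t` = half the degree shift of `φ`; his `T_Γ` with `Γ ↔ φ`, `n^{deg Γ − 3} = n^{t − 1}`), defined summand-wise
  on `ℍₚ = ⨁ᵢ Φ p i` by the FINITE sum `n ≤ p` (the printed sum is locally finite: `𝔮₋ₙ` kills `ℍₚ` for `n > p` by
  the bi-degree axiom).
* `fiberwise c` (an operator acting on each `ℍₚ` by a given `c p`, e.g. cup product with a class of `S^[p]`),
  `restrictFock T p` (the `ℍₚ → ℍₚ` block of `T`), `superBracket` and `nestedBracket q` (iterated super-commutators
  `[⋯[[𝔣, 𝔮_{m₁}(a₁)], 𝔮_{m₂}(a₂)], …]` with the sign of (2.7), parities accumulated) are the words in which the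
  cup-product theorems of Lehn / Li–Qin–Wang and Oberdieck's Lemma 3.4 are stated in the sequels.

Junk analysis: all definitions are total; outside the axioms (`IsHeisenbergRepresentation`) `transferOp` is just
some operator.  Nothing here asserts existence of a representation.

## Not here

Vertex operators / normally ordered products of arbitrary length (LQW Def. 4.3), the Virasoro operators `𝔏ₙ`
for `n ≠ 0`, the super-symmetric algebra model `S*W₊` and the isomorphism `S*W₊ ≅ ℍ` as a construction; the
geometric structures (sequel files `NakajimaOperators`, `TautologicalCupProduct`, `LefschetzDualTransfer`).
-/

noncomputable section

open DirectSum TensorProduct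

universe u v w

namespace Literature.AlgebraicGeometry.HilbertScheme

variable {K : Type u} [Field K]
variable {A : ℕ → Type v} [∀ i, AddCommGroup (A i)] [∀ i, Module K (A i)]
variable {Φ : ℕ → ℕ → Type w} [∀ n i, AddCommGroup (Φ n i)] [∀ n i, Module K (Φ n i)]

/-! ### The bigraded Fock carrier -/

variable (Φ) in
/-- The **bigraded Fock carrier** `ℍ = ⨁ₙ ⨁ᵢ ℍ^{n,i}` of a family `Φ n i` (intended: `ℍ^{n,i} = Hⁱ(S^[n])`, so
that `ℍ = ⨁ₙ H*(S^[n])` with the tree's `totalCohomology`). [cite: LiQinWang2002, Def. 2.5 (i) p. 4] -/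
abbrev Fock : Type (max w 0) :=
  ⨁ n : ℕ, ⨁ i : ℕ, Φ n i

variable (Φ) in
/-- The `n`-th summand `ℍₙ = ⨁ᵢ ℍ^{n,i}` (intended: `H*(S^[n])`). [cite: LiQinWang2002, Def. 2.5 (i) p. 4] -/
abbrev FockSummand (n : ℕ) : Type (max w 0) :=
  ⨁ i : ℕ, Φ n i

variable (K Φ) in
/-- The inclusion `ℍ^{n,i} → ℍ` of one bigraded piece. [cite: LiQinWang2002, Def. 2.5 (i) p. 4] -/
abbrev Fock.of (n i : ℕ) : Φ n i →ₗ[K] Fock Φ :=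
  lof K ℕ (fun n ↦ FockSummand Φ n) n ∘ₗ lof K ℕ (Φ n) i

variable (K Φ) in
/-- The inclusion `ℍₙ → ℍ` of the `n`-th summand. [cite: LiQinWang2002, Def. 2.5 (i) p. 4] -/
abbrev Fock.ofSummand (n : ℕ) : FockSummand Φ n →ₗ[K] Fock Φ :=
  lof K ℕ (fun n ↦ FockSummand Φ n) n

variable (K Φ) in
/-- **The bigraded piece `ℍ^{p,d} ⊆ ℍ` for `p, d ∈ ℤ`**: the range of `ℍ^{p,d} → ℍ` when `p, d ≥ 0`, and `⊥`
otherwise (so that an operator "of bi-degree `(ℓ, m)`", `ℓ ∈ ℤ`, maps `ℍ^{n,i}` into `ℍ^{n+ℓ, i+m}`, which is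
`0` below the axes). [cite: LiQinWang2002, Def. 2.5 (ii) p. 4] -/
def bidegPart (p d : ℤ) : Submodule K (Fock Φ) :=
  if 0 ≤ p ∧ 0 ≤ d then LinearMap.range (Fock.of K Φ p.toNat d.toNat) else ⊥

/-- Below the axes the bigraded pieces vanish (first index). [cite: LiQinWang2002, Def. 2.5 (ii) p. 4] -/
theorem bidegPart_of_neg_left {p : ℤ} (hp : p < 0) (d : ℤ) : bidegPart K Φ p d = ⊥ := by
  rw [bidegPart, if_neg]
  exact fun h ↦ (not_le.mpr hp) h.1

/-- Below the axes the bigraded pieces vanish (second index). [cite: LiQinWang2002, Def. 2.5 (ii) p. 4] -/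
theorem bidegPart_of_neg_right (p : ℤ) {d : ℤ} (hd : d < 0) : bidegPart K Φ p d = ⊥ := by
  rw [bidegPart, if_neg]
  exact fun h ↦ (not_le.mpr hd) h.2

/-- On the axes, `ℍ^{n,i}` is the range of the inclusion of `Φ n i`. [cite: LiQinWang2002, Def. 2.5 (ii) p. 4] -/
theorem bidegPart_natCast (n i : ℕ) : bidegPart K Φ n i = LinearMap.range (Fock.of K Φ n i) := by
  rw [bidegPart, if_pos ⟨Int.natCast_nonneg n, Int.natCast_nonneg i⟩]
  rfl

/-- A homogeneous vector lies in its bigraded piece. [cite: LiQinWang2002, Def. 2.5 (ii) p. 4] -/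
theorem of_mem_bidegPart (n i : ℕ) (x : Φ n i) : Fock.of K Φ n i x ∈ bidegPart K Φ n i := by
  rw [bidegPart_natCast]
  exact LinearMap.mem_range_self _ x

/-! ### The axioms of a Heisenberg representation -/

/-- **`(q, vac)` is a representation of the Heisenberg superalgebra of `(⨁ᵢ A i, B)` on the Fock carrier `ℍ`,
highest weight with vacuum `vac`** — the properties of Nakajima's operators as printed: `𝔮₀ = 0` (Def. 2.9);
the super-commutation relations `[𝔮ₘ(a), 𝔮ₗ(b)] = m · δ_{m+l} · ⟨a, b⟩ · Id` (Thm. 2.16 (i), bracket (2.7) with the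
parities `i = |a|`, `j = |b|`); `𝔮ₘ(a)` has bi-degree `(m, 2m − 2 + |a|)` (Def. 2.9); the vacuum is a non-zero
vector of bi-degree `(0, 0)` (Def. 2.5 (i)); `ℍ` is generated by the vacuum under the creation operators (LQW
p. 5, Lehn Cor. 2.6: the only submodule containing `vac` and stable under all `𝔮ₘ(v)`, `m > 0`, is `ℍ`).  `B` is the pairing `⟨a, b⟩` (intended `∫_S ab`).
[cite: LiQinWang2002, Def. 2.5, (2.7), Def. 2.9 and Thm. 2.16 (i) (pp. 4–5)] [cite: Lehn1999, Thm. 2.5 and Cor. 2.6] -/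
structure IsHeisenbergRepresentation (B : (⨁ i, A i) →ₗ[K] (⨁ i, A i) →ₗ[K] K)
    (q : ℤ → (⨁ i, A i) →ₗ[K] Module.End K (Fock Φ)) (vac : Fock Φ) : Prop where
  /-- `𝔮₀ = 0`. -/
  q_zero : q 0 = 0
  /-- The Heisenberg super-relations: `𝔮ₘ(a)𝔮ₗ(b) − (−1)^{|a||b|} 𝔮ₗ(b)𝔮ₘ(a) = δ_{m+l,0} m ⟨a, b⟩ Id`. -/
  bracket : ∀ (m l : ℤ) (i j : ℕ) (a : A i) (b : A j),
    q m (lof K ℕ A i a) * q l (lof K ℕ A j b) -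
        ((-1 : K) ^ (i * j)) • (q l (lof K ℕ A j b) * q m (lof K ℕ A i a)) =
      if m + l = 0 then ((m : K) * B (lof K ℕ A i a) (lof K ℕ A j b)) • (1 : Module.End K (Fock Φ)) else 0
  /-- `𝔮ₘ(a)` has bi-degree `(m, 2m − 2 + |a|)`: it maps `ℍ^{n,k}` into `ℍ^{n+m, k+2m−2+|a|}` (`= 0` below the axes). -/
  bidegree : ∀ (m : ℤ) (i : ℕ) (a : A i) (n k : ℕ) (x : Φ n k),
    q m (lof K ℕ A i a) (Fock.of K Φ n k x) ∈ bidegPart K Φ ((n : ℤ) + m) ((k : ℤ) + 2 * m - 2 + i)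
  /-- The vacuum has bi-degree `(0, 0)`. -/
  vac_mem : vac ∈ bidegPart K Φ 0 0
  /-- The vacuum is non-zero. -/
  vac_ne_zero : vac ≠ 0
  /-- `ℍ` is generated by the vacuum under the CREATION operators `𝔮ₘ(v)`, `m > 0` (LQW: "a linear basis of `ℍ`
  is given by `𝔮_{i₁}(α₁) ⋯ 𝔮_{i_k}(α_k)|0⟩`, `i₁ ≥ ⋯ ≥ i_k > 0`"; Lehn Cor. 2.6: `S*W₊ ≅ ℍ`). -/
  cyclic : ∀ W : Submodule K (Fock Φ), vac ∈ W →
    (∀ (m : ℤ), 0 < m → ∀ (v : ⨁ i, A i), ∀ x ∈ W, q m v x ∈ W) → W = ⊤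

namespace IsHeisenbergRepresentation

variable {B : (⨁ i, A i) →ₗ[K] (⨁ i, A i) →ₗ[K] K} {q : ℤ → (⨁ i, A i) →ₗ[K] Module.End K (Fock Φ)}
  {vac : Fock Φ}

/-- The bi-degree axiom for an arbitrary (inhomogeneous) coefficient `v ∈ ⨁ᵢ A i`, second index forgotten:
`𝔮ₘ(v)` maps `ℍ^{n,k}` into `⨆_d ℍ^{n+m,d}`. [cite: LiQinWang2002, Def. 2.9 p. 5] -/
theorem apply_of_mem_iSup (h : IsHeisenbergRepresentation B q vac) (m : ℤ) (v : ⨁ i, A i) (n k : ℕ)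
    (x : Φ n k) : q m v (Fock.of K Φ n k x) ∈ ⨆ d : ℤ, bidegPart K Φ ((n : ℤ) + m) d := by
  induction v using DirectSum.induction_on with
  | zero => simp only [map_zero, LinearMap.zero_apply, Submodule.zero_mem]
  | of i a =>
    rw [← DirectSum.lof_eq_of K]
    exact Submodule.mem_iSup_of_mem _ (h.bidegree m i a n k x)
  | add v w hv hw =>
    rw [map_add, LinearMap.add_apply]
    exact Submodule.add_mem _ hv hw

/-- **The annihilation operators kill the vacuum**: `𝔮ₘ(v) vac = 0` for `m < 0` (bi-degree `(m, ·)` lands in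
`ℍ^{m,·} = 0`; Lehn: "`W₋` … annihilates the vacuum vector for obvious degree reasons").
[cite: Lehn1999, §2.2 p. 8] [cite: LiQinWang2002, Def. 2.9 p. 5] -/
theorem q_apply_vac_eq_zero (h : IsHeisenbergRepresentation B q vac) {m : ℤ} (hm : m < 0)
    (v : ⨁ i, A i) : q m v vac = 0 := by
  have hvac := h.vac_mem
  rw [show ((0 : ℤ)) = ((0 : ℕ) : ℤ) from rfl, bidegPart_natCast] at hvac
  obtain ⟨x, hx⟩ := hvac
  rw [← hx]
  have hmem := h.apply_of_mem_iSup m v 0 0 x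
  have hbot : (⨆ d : ℤ, bidegPart K Φ (((0 : ℕ) : ℤ) + m) d) = ⊥ := by
    rw [iSup_eq_bot]
    intro d
    exact bidegPart_of_neg_left (by push_cast; omega) d
  rw [hbot, Submodule.mem_bot] at hmem
  exact hmem

/-- The operators `𝔮ₘ(v)`, `m ≤ 0`, kill the vacuum (`𝔮₀ = 0`). [cite: LiQinWang2002, Def. 2.9 p. 5] -/
theorem q_apply_vac_eq_zero_of_nonpos (h : IsHeisenbergRepresentation B q vac) {m : ℤ} (hm : m ≤ 0)
    (v : ⨁ i, A i) : q m v vac = 0 := by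
  rcases hm.lt_or_eq with hm | rfl
  · exact h.q_apply_vac_eq_zero hm v
  · rw [h.q_zero, LinearMap.zero_apply, LinearMap.zero_apply]

/-- Two operators with the same commutators with every CREATION operator `𝔮ₘ(v)`, `m > 0`, and the same value on
the vacuum are EQUAL (cyclicity; the form in which LQW's and Lehn's "by Schur's lemma … for degree reasons"
arguments are used). [cite: Lehn1999, Cor. 2.6 and proof of Thm. 3.10 p. 12] -/
theorem ext_of_commute (h : IsHeisenbergRepresentation B q vac) {T T' : Module.End K (Fock Φ)}
    (hvac : T vac = T' vac)
    (hcomm : ∀ (m : ℤ), 0 < m → ∀ (v : ⨁ i, A i), T * q m v - q m v * T = T' * q m v - q m v * T') :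
    T = T' := by
  have hW : LinearMap.ker (T - T') = ⊤ := by
    refine h.cyclic _ ?_ ?_
    · rw [LinearMap.mem_ker, LinearMap.sub_apply, hvac, sub_self]
    · intro m hm v x hx
      rw [LinearMap.mem_ker, LinearMap.sub_apply, sub_eq_zero] at hx ⊢
      have h1 := LinearMap.congr_fun (hcomm m hm v) x
      simp only [LinearMap.sub_apply, Module.End.mul_apply, hx] at h1
      -- `T(q x) - q(T' x) = T'(q x) - q(T' x)`
      exact sub_left_injective h1
  refine LinearMap.ext fun x ↦ ?_
  have hx : x ∈ LinearMap.ker (T - T') := by rw [hW]; exact Submodule.mem_top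
  rwa [LinearMap.mem_ker, LinearMap.sub_apply, sub_eq_zero] at hx

end IsHeisenbergRepresentation

/-! ### Two-point operators, Casimir elements, transfer operators -/

section Operators

variable {V : Type v} [AddCommGroup V] [Module K V] {F : Type w} [AddCommGroup F] [Module K F]

variable (K) in
/-- **The two-point operator** `a ⊗ b ↦ 𝔮ₘ(a)𝔮ₗ(b)`, extended linearly to `V ⊗ V` — the meaning of the printed
`𝔮ₘ𝔮ₗ(Γ)` for a class `Γ = Σⱼ aⱼ ⊗ bⱼ` of `S × S` in its Künneth decomposition ("`𝔮ₘ𝔮ₗ δ(α)` for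
`Σᵢ 𝔮ₘ(αᵢ′)𝔮ₗ(αᵢ″)` if `δ(α) = Σᵢ αᵢ′ ⊗ αᵢ″`"). [cite: Lehn1999, §3.1 p. 8] [cite: LiQinWang2002, Def. 2.9 (iii) p. 5] -/
def pairOp (q : ℤ → V →ₗ[K] Module.End K F) (m l : ℤ) : V ⊗[K] V →ₗ[K] Module.End K F :=
  TensorProduct.lift ((LinearMap.mul K (Module.End K F)).compl₁₂ (q m) (q l))

/-- On pure tensors the two-point operator is `𝔮ₘ(a) ∘ 𝔮ₗ(b)`. [cite: Lehn1999, §3.1 p. 8] -/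
@[simp]
theorem pairOp_tmul (q : ℤ → V →ₗ[K] Module.End K F) (m l : ℤ) (a b : V) :
    pairOp K q m l (a ⊗ₜ b) = q m a * q l b := by
  simp [pairOp]

variable (K) in
/-- **`C ∈ V ⊗ V` is a Casimir element of the pairing `B`**: writing `C = Σᵢ eᵢ ⊗ εᵢ`, `Σᵢ ⟨eᵢ, v⟩ εᵢ = v` for every
`v` (i.e. `(εᵢ)` is the basis dual to `(eᵢ)` under `B`; exists uniquely for `B` non-degenerate on a finite-dimensional
`V` — on `H*(S)` by Poincaré duality — and then `γ ↦ Σᵢ eᵢ ⊗ γεᵢ` is, up to the graded swap, Lehn's `δ`, "the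
linear map adjoint to the cup-product map"). [cite: Lehn1999, §3.1 p. 8] -/
def IsCasimir (B : V →ₗ[K] V →ₗ[K] K) (C : V ⊗[K] V) : Prop :=
  ∀ v : V, TensorProduct.lift ((LinearMap.lsmul K V).comp (B.flip v)) C = v

/-- Unfolding `IsCasimir` on a finite sum of pure tensors: `Σᵢ ⟨eᵢ, v⟩ • εᵢ = v`. [cite: Lehn1999, §3.1 p. 8] -/
theorem isCasimir_sum_tmul_iff {ι : Type*} (s : Finset ι) (e ε : ι → V) (B : V →ₗ[K] V →ₗ[K] K) :
    IsCasimir K B (∑ i ∈ s, e i ⊗ₜ[K] ε i) ↔ ∀ v : V, ∑ i ∈ s, B (e i) v • ε i = v := by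
  simp [IsCasimir, map_sum]

end Operators

section Transfer

variable {V : Type v} [AddCommGroup V] [Module K V]

variable (K) in
/-- The `n`-th term `Σᵢ 𝔮ₙ(φ εᵢ) 𝔮₋ₙ(eᵢ)` of a transfer operator, for `C = Σᵢ eᵢ ⊗ εᵢ` and an endomorphism `φ` of the
coefficient space (Oberdieck's `𝔮ₙ𝔮₋ₙ(Γ′)` for the correspondence `Γ ↔ φ`, `Γ(γ) = Σᵢ ⟨eᵢ, γ⟩ φ(εᵢ)`… read through
`IsCasimir`). [cite: Oberdieck2021, §3.2 (definition of T_Γ) p. 7] -/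
def transferTerm (q : ℤ → V →ₗ[K] Module.End K (Fock Φ)) (C : V ⊗[K] V) (φ : V →ₗ[K] V) (n : ℤ) :
    Module.End K (Fock Φ) :=
  TensorProduct.lift ((LinearMap.mul K (Module.End K (Fock Φ))).compl₁₂ ((q n).comp φ) (q (-n))).flip C

/-- On a pure tensor `e ⊗ ε` the `n`-th transfer term is `𝔮ₙ(φ ε) ∘ 𝔮₋ₙ(e)`. [cite: Oberdieck2021, §3.2 p. 7] -/
@[simp]
theorem transferTerm_tmul (q : ℤ → V →ₗ[K] Module.End K (Fock Φ)) (e ε : V) (φ : V →ₗ[K] V) (n : ℤ) :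
    transferTerm K q (e ⊗ₜ ε) φ n = q n (φ ε) * q (-n) e := by
  simp [transferTerm]

variable (K) in
/-- **Oberdieck's transfer operator** `T(φ) = −Σ_{n ≥ 1} n^{t−1} Σᵢ 𝔮ₙ(φ εᵢ) 𝔮₋ₙ(eᵢ)` of an endomorphism `φ` of the
coefficient space of degree shift `2t` (his `T_Γ = −Σ_{n>0} n^{deg Γ − 3} 𝔮ₙ𝔮₋ₙ(Γ′)` for a homogeneous correspondence
`Γ ∈ A^{deg Γ}(S × S)`, `deg Γ − 3 = t − 1`; e.g. `t = 1` for cup product with a class of `H²(S)`, `t = 0` for the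
degree operator, `t = −1` for a dual Lefschetz operator of `S`).  Defined on the summand `ℍₚ` by the finite sum
`1 ≤ n ≤ p` (the printed sum is locally finite there); `n^{t−1}` is an integer power in the field `K`.
[cite: Oberdieck2021, §3.2 (definition of T_Γ), Lemma 3.4 and Cor. 3.5 (p. 7)] -/
def transferOp (q : ℤ → V →ₗ[K] Module.End K (Fock Φ)) (C : V ⊗[K] V) (t : ℤ) (φ : V →ₗ[K] V) :
    Module.End K (Fock Φ) :=
  -DirectSum.toModule K ℕ (Fock Φ) fun p ↦
    (∑ n ∈ Finset.Icc 1 p, ((n : K) ^ (t - 1)) • transferTerm K q C φ (n : ℤ)) ∘ₗ Fock.ofSummand K Φ p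

/-- The transfer operator on the summand `ℍₚ`: the finite sum `−Σ_{n=1}^{p} n^{t−1} (Σᵢ 𝔮ₙ(φεᵢ)𝔮₋ₙ(eᵢ))`.
[cite: Oberdieck2021, §3.2 p. 7] -/
theorem transferOp_apply_ofSummand (q : ℤ → V →ₗ[K] Module.End K (Fock Φ)) (C : V ⊗[K] V) (t : ℤ)
    (φ : V →ₗ[K] V) (p : ℕ) (x : FockSummand Φ p) :
    transferOp K q C t φ (Fock.ofSummand K Φ p x) =
      -∑ n ∈ Finset.Icc 1 p, ((n : K) ^ (t - 1)) • transferTerm K q C φ (n : ℤ) (Fock.ofSummand K Φ p x) := by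
  simp only [transferOp, LinearMap.neg_apply, DirectSum.toModule_lof, LinearMap.coe_comp, Function.comp_apply,
    LinearMap.coe_sum, Finset.sum_apply, LinearMap.smul_apply]

end Transfer

/-! ### Operators acting summand-wise; blocks; super-commutators -/

section Fiberwise

variable (K Φ) in
/-- The operator acting on each summand `ℍₚ` by a given endomorphism `c p` (e.g. "`𝔊(γ) = ⨁ₙ G(γ, n)` where `G(γ, n)`
acts on `ℍₙ = H*(X^[n])` by the cup product"). [cite: LiQinWang2002, Def. 5.1 (i) p. 12] -/
def fiberwise (c : (p : ℕ) → Module.End K (FockSummand Φ p)) : Module.End K (Fock Φ) :=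
  DirectSum.toModule K ℕ (Fock Φ) fun p ↦ Fock.ofSummand K Φ p ∘ₗ c p

/-- A summand-wise operator acts on `ℍₚ` by its `p`-th component. [cite: LiQinWang2002, Def. 5.1 (i) p. 12] -/
@[simp]
theorem fiberwise_apply_ofSummand (c : (p : ℕ) → Module.End K (FockSummand Φ p)) (p : ℕ) (x : FockSummand Φ p) :
    fiberwise K Φ c (Fock.ofSummand K Φ p x) = Fock.ofSummand K Φ p (c p x) := by
  simp [fiberwise]

variable (K Φ) in
/-- The `ℍₚ → ℍₚ` block of an operator on `ℍ` (for an operator of bi-degree `(0, ·)`, such as a transfer operator or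
a cup-product operator, this is its restriction "`𝔊ᵢ(γ)|_{ℍₙ}`"). [cite: LiQinWang2002, Thm. 1.2 p. 2] -/
def restrictFock (T : Module.End K (Fock Φ)) (p : ℕ) : Module.End K (FockSummand Φ p) :=
  DirectSum.component K ℕ (fun n ↦ FockSummand Φ n) p ∘ₗ T ∘ₗ Fock.ofSummand K Φ p

/-- The block of a summand-wise operator is the given component. [cite: LiQinWang2002, Def. 5.1 p. 12] -/
@[simp]
theorem restrictFock_fiberwise (c : (p : ℕ) → Module.End K (FockSummand Φ p)) (p : ℕ) :
    restrictFock K Φ (fiberwise K Φ c) p = c p := by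
  ext x
  simp [restrictFock, fiberwise]

end Fiberwise

section Brackets

variable {F : Type w} [AddCommGroup F] [Module K F]

variable (K) in
/-- **The super-commutator** `[𝔣, 𝔤] = 𝔣𝔤 − (−1)^{|𝔣||𝔤|} 𝔤𝔣` of two operators with GIVEN parities `pf`, `pg` (the
cohomological degrees of their bi-degrees, mod `2`). [cite: LiQinWang2002, (2.7) p. 4] -/
def superBracket (f g : Module.End K F) (pf pg : ℕ) : Module.End K F :=
  f * g - ((-1 : K) ^ (pf * pg)) • (g * f)

/-- For an even operator the super-commutator is the commutator. [cite: LiQinWang2002, (2.7) p. 4] -/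
theorem superBracket_of_even_left (f g : Module.End K F) {pf : ℕ} (hpf : Even pf) (pg : ℕ) :
    superBracket K f g pf pg = f * g - g * f := by
  rw [superBracket, (hpf.mul_right pg).neg_one_pow, one_smul]

variable {V : Type v} [AddCommGroup V] [Module K V]

variable (K A) in
/-- **Iterated super-commutators with Heisenberg operators**: for an operator `𝔣` of parity `pf` and a list
`[(m₁, a₁), …, (m_k, a_k)]` of modes and homogeneous coefficients `aⱼ ∈ A iⱼ`, the operator
`[⋯[[𝔣, 𝔮_{m₁}(a₁)], 𝔮_{m₂}(a₂)], …, 𝔮_{m_k}(a_k)]` (brackets (2.7); `𝔮ₘ(a)` has the parity of `|a|`, parities add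
along the nesting) — the shape of LQW's Lemma 3.7 / 4.6 / Thm. 4.10 and of Lehn's Thm. 3.10.
[cite: LiQinWang2002, Lemma 4.6 and Thm. 4.10 (p. 10)] [cite: Lehn1999, Thm. 3.10] -/
def nestedBracket (q : ℤ → (⨁ i, A i) →ₗ[K] Module.End K F) :
    Module.End K F → ℕ → List (ℤ × Σ i, A i) → Module.End K F
  | f, _, [] => f
  | f, pf, (m, ⟨i, a⟩) :: rest =>
    nestedBracket q (superBracket K f (q m (lof K ℕ A i a)) pf i) (pf + i) rest

/-- No brackets: the operator itself. [cite: LiQinWang2002, Thm. 4.10 p. 10] -/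
@[simp]
theorem nestedBracket_nil (q : ℤ → (⨁ i, A i) →ₗ[K] Module.End K F) (f : Module.End K F) (pf : ℕ) :
    nestedBracket K A q f pf [] = f :=
  rfl

/-- One more bracket on the left. [cite: LiQinWang2002, Thm. 4.10 p. 10] -/
@[simp]
theorem nestedBracket_cons (q : ℤ → (⨁ i, A i) →ₗ[K] Module.End K F) (f : Module.End K F) (pf : ℕ) (m : ℤ)
    (i : ℕ) (a : A i) (rest : List (ℤ × Σ i, A i)) :
    nestedBracket K A q f pf ((m, ⟨i, a⟩) :: rest) =
      nestedBracket K A q (superBracket K f (q m (lof K ℕ A i a)) pf i) (pf + i) rest :=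
  rfl

variable (K A) in
/-- The product `γ · a₁ ⋯ a_k` in the coefficient algebra along a list of homogeneous coefficients, for a given
multiplication `mul` (intended: the tree's `totalCup`). [cite: LiQinWang2002, Thm. 4.10 p. 10] -/
def listProduct (mul : (⨁ i, A i) →ₗ[K] (⨁ i, A i) →ₗ[K] (⨁ i, A i)) (γ : ⨁ i, A i)
    (l : List (ℤ × Σ i, A i)) : ⨁ i, A i :=
  l.foldl (fun x p ↦ mul x (lof K ℕ A p.2.1 p.2.2)) γ

/-- The sum of the modes `m₁ + ⋯ + m_k` of a list. [cite: LiQinWang2002, Thm. 4.10 p. 10] -/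
def modeSum (l : List (ℤ × Σ i, A i)) : ℤ :=
  (l.map Prod.fst).sum

/-- The product `(−m₁) ⋯ (−m_k)` of the negated modes of a list, in `K`. [cite: LiQinWang2002, Thm. 4.10 p. 10] -/
def negModeProd (l : List (ℤ × Σ i, A i)) : K :=
  (l.map fun p ↦ (-(p.1 : K))).prod

end Brackets

end Literature.AlgebraicGeometry.HilbertScheme

end
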